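import Mathlib.MeasureTheory.Integral.Prod
import Mathlib.MeasureTheory.Measure.Haar.InnerProductSpace
import Mathlib.MeasureTheory.Integral.IntervalIntegral.FundThmCalculus
import Mathlib.Analysis.ODE.Gronwall
import Mathlib.Analysis.Calculus.LineDeriv.IntegrationByParts
import Literature.Geometry.Lorentzian.KerrHyperboloidalLeaves
import Literature.Geometry.Lorentzian.KerrSchildEnergyCurrent
import HarnessLib

/-!
# The energy estimate for divergence-form wave operators on generalised Kerr–Schild backgrounds
# over `ℝ⁴`

(family `gr`; namespace `Literature.Geometry.Lorentzian`, results in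
`Literature.Geometry.Lorentzian.KerrSchild.Background`)

For a generalised Kerr–Schild background `B` on `ℝ⁴` (`g⁻¹ = η⁻¹ − φ ℓ♯ ⊗ ℓ♯`, `0 ≤ φ ≤ Φ`,
`KerrSchild.Background` of `KerrSchildWaveCauchyProblem.lean`) and its divergence-form wave operator
`□_G w = ∑_μ ∂_μ (g^{μν} ∂_ν w)` (`KerrSchild.waveOperator`; for Kerr itself this is `□_g`,
`Kerr.dalembertian_eq_waveOperator`), this file **proves the a-priori energy estimate**

  `∫_{ℝ³} ∑_μ (∂_μ w)²(τ, y) dy ≤ K (∫_{ℝ³} ∑_μ (∂_μ w)²(0, y) dy + ∫_{0 ≤ t ≤ T} (□_G w)² d⁴x)`,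
  `0 ≤ τ ≤ T`, `K = 18 (1 + Φ)² e^{(1 + 192 (1 + Φ) D) T}`,

for every `w ∈ C²(ℝ⁴)` vanishing on `{−1 < t < T + 1} ∩ {‖x⃗‖ > ρ}` (spatially compact support over
the slab), where `D` bounds `|∂_μ g^{αβ}|` on `{0 ≤ t ≤ T} ∩ {‖x⃗‖ ≤ ρ}`
(`KerrSchild.Background.lintegral_energy_estimate`, with the real-valued ball version
`KerrSchild.Background.ballEnergy_estimate`). This is the estimate
"`∫_{Σ_τ} J^N(u)·n ≤ C(T, N, {Σ_τ}) (∫_{Σ_0} J^N(u)·n + ‖□u‖²_{L²(R_{[0,T]})})` […] (see for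
example [Taylor], chapter 2.8)" invoked in Sbierski's proof of Anal. PDE 8 (2015), Thm. 2.1, here
for the spacetime `(ℝ⁴, η + φ ℓ ⊗ ℓ)` with the time function `t` and `N = −(dt)♯` (his choice in
§7A); the multiplier method of Alinhac, *Hyperbolic PDE* (2009), Ch. 7.

## Proof

The current is `P^μ = T^{μ0}` (`KerrSchild.normalCurrent`, previous file), whose density
`P⁰ = T(dt, dt)` is coercive, `∑ p² ≤ 6 P⁰ ≤ 18 (1 + Φ)² ∑ p²`, and whose divergence is
`(□_G w) X + R`, `|R| ≤ 32 (1 + Φ) D ∑ p²` (previous file). The energy identity in the ball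
`B_ρ` (`ballEnergy_sub_eq`) is obtained *without* the divergence theorem: the fundamental theorem
of calculus in `t` pointwise in `y`, Fubini on `[0, τ] × B_ρ`, and the vanishing of
`∫_{ℝ³} ∂_{y_i}(·)` for compactly supported `C¹` functions (Mathlib's integration by parts), the
current vanishing near `{‖y‖ = ρ}`. Then `(□w) X + R ≤ ½ (□w)² + (1 + 192 (1 + Φ) D) P⁰` and
Grönwall's inequality (Mathlib's `norm_le_gronwallBound_of_norm_deriv_right_le`, applied to the
primitive of the ball energy) give the ball estimate; the global `[0, ∞]`-valued form follows by
Tonelli in `(t, y)` (`E4.setLIntegral_timeSlab_eq`, from the measure-preserving splitting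
`E4.timeSplit : E4 ≃ᵐ ℝ × E3`).

Also recorded: the calculus of the slice maps `t ↦ (t, y)`, `y ↦ (t, y)`
(`E4.hasDerivAt_ofTimeSpace_left`, `E4.fderiv_eq_of_data_eq`: functions with the same Cauchy data
on `{t = 0}` have the same differential there; `E4.hasFDerivAt_ofTimeSpace`,
`E4.contDiff_ofTimeSpace` are those of `KerrHyperboloidalLeaves.lean`) and `∫_{E3} ∂_v g = 0` for
`g ∈ C¹_c` (`integral_fderiv_apply_eq_zero_of_hasCompactSupport`).

## References

* J. Sbierski, Anal. PDE 8 (2015) 1379–1420 (arXiv:1311.2477), §2, proof of Thm. 2.1 (the energy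
  estimate), §7A (`N = −(dt*)♯`) (key `Sbierski2015`).
* S. Alinhac, *Hyperbolic partial differential equations*, Springer 2009, Ch. 7 (energy inequality
  by the multiplier method).
* M. Dafermos, I. Rodnianski, arXiv:0811.0354, App. D (currents `J^V`, `K^V`, divergence identity)
  (key `DafermosRodnianski2008`).
* R. P. Kerr, A. Schild, 1965, §2 (key `KerrSchild1965`).
-/

noncomputable section

open Set Filter
open scoped ContDiff Topology

namespace Literature.Geometry.Lorentzian

open _root_.MeasureTheory Metric
open scoped ENNReal

/-! ### Lebesgue measure on `E4` as the product of the measures on time and space -/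

namespace E4

/-- The measurable equivalence `E4 ≃ᵐ ℝ × E3`, `x ↦ (x⁰, x⃗)`, a chain of Mathlib's
volume-preserving identifications `EuclideanSpace ℝ (Fin n) ≃ᵐ (Fin n → ℝ)` and
`MeasurableEquiv.piFinSuccAbove` at the index `0`; its inverse is `(t, y) ↦ ofTimeSpace t y`
(`timeSplit_symm_apply`). [folklore] -/
def timeSplit : E4 ≃ᵐ ℝ × E3 :=
  ((MeasurableEquiv.toLp 2 (Fin 4 → ℝ)).symm.trans
    (MeasurableEquiv.piFinSuccAbove (fun _ => ℝ) 0)).trans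
    (MeasurableEquiv.prodCongr (MeasurableEquiv.refl ℝ) (MeasurableEquiv.toLp 2 (Fin 3 → ℝ)))

/-- The inverse of `timeSplit` is `(t, y) ↦ (t, y)`. [folklore] -/
theorem timeSplit_symm_apply (p : ℝ × E3) : timeSplit.symm p = ofTimeSpace p.1 p.2 := by
  change WithLp.toLp 2 ((MeasurableEquiv.piFinSuccAbove (fun _ : Fin 4 => ℝ) 0).symm
      (p.1, WithLp.ofLp p.2)) = _
  rw [MeasurableEquiv.piFinSuccAbove_symm_apply]
  simp only [Fin.insertNthEquiv, Equiv.coe_fn_mk, Fin.insertNth_zero']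
  rfl

/-- `timeSplit` preserves Lebesgue measure. [folklore] -/
theorem measurePreserving_timeSplit : MeasurePreserving timeSplit volume volume := by
  have h1 : MeasurePreserving (MeasurableEquiv.toLp 2 (Fin 4 → ℝ)).symm volume volume :=
    EuclideanSpace.volume_preserving_symm_measurableEquiv_toLp (Fin 4)
  have h2 : MeasurePreserving (MeasurableEquiv.piFinSuccAbove (fun _ : Fin 4 => ℝ) 0) volume
      volume :=
    volume_preserving_piFinSuccAbove (fun _ => ℝ) 0
  have h3 : MeasurePreserving
      (MeasurableEquiv.prodCongr (MeasurableEquiv.refl ℝ) (MeasurableEquiv.toLp 2 (Fin 3 → ℝ)))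
      volume volume :=
    (MeasurePreserving.id volume).prod (PiLp.volume_preserving_toLp (Fin 3))
  exact (h1.trans h2).trans h3

/-- `timeSplit.symm = ofTimeSpace` preserves Lebesgue measure. [folklore] -/
theorem measurePreserving_timeSplit_symm : MeasurePreserving timeSplit.symm volume volume :=
  measurePreserving_timeSplit.symm _

/-- **Tonelli in time and space**: for a measurable `f : E4 → [0, ∞]`,
`∫⁻ f d⁴x = ∫⁻ dt ∫⁻ dy f(t, y)`. [folklore] -/
theorem lintegral_eq_lintegral_time_space (f : E4 → ℝ≥0∞) (hf : Measurable f) :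
    ∫⁻ x, f x = ∫⁻ t : ℝ, ∫⁻ y : E3, f (ofTimeSpace t y) := by
  rw [← measurePreserving_timeSplit_symm.lintegral_comp hf, Measure.volume_eq_prod,
    lintegral_prod (fun a ↦ f (timeSplit.symm a)) (hf.comp timeSplit.symm.measurable).aemeasurable]
  simp only [timeSplit_symm_apply]

/-- **Tonelli over a time slab**: for a measurable `f : E4 → [0, ∞]` and `S ⊆ ℝ` measurable,
`∫⁻_{x⁰ ∈ S} f d⁴x = ∫⁻_{t ∈ S} dt ∫⁻ dy f(t, y)`. [folklore] -/
theorem setLIntegral_timeSlab_eq (f : E4 → ℝ≥0∞) (hf : Measurable f) {S : Set ℝ}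
    (hS : MeasurableSet S) :
    ∫⁻ x in {x : E4 | x 0 ∈ S}, f x = ∫⁻ t in S, ∫⁻ y : E3, f (ofTimeSpace t y) := by
  have hmeas : MeasurableSet {x : E4 | x 0 ∈ S} := (E4.dx 0).continuous.measurable hS
  rw [← lintegral_indicator hmeas, lintegral_eq_lintegral_time_space _ (hf.indicator hmeas),
    ← lintegral_indicator hS]
  refine lintegral_congr fun t ↦ ?_
  by_cases ht : t ∈ S
  · rw [Set.indicator_of_mem ht]
    refine lintegral_congr fun y ↦ ?_
    rw [Set.indicator_of_mem (show ofTimeSpace t y ∈ {x : E4 | x 0 ∈ S} by simpa using ht)]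
  · rw [Set.indicator_of_notMem ht]
    have : ∀ y : E3, ({x : E4 | x 0 ∈ S}.indicator f) (ofTimeSpace t y) = 0 := fun y ↦
      Set.indicator_of_notMem (show ofTimeSpace t y ∉ {x : E4 | x 0 ∈ S} by simpa using ht) _
    simp only [this, lintegral_zero]

/-! ### Calculus along the slices `t ↦ (t, y)` and `y ↦ (t, y)` -/

/-- `t ↦ (t, y)` has derivative `∂_{t}`. [folklore] -/
theorem hasDerivAt_ofTimeSpace_left (t : ℝ) (y : E3) :
    HasDerivAt (fun s : ℝ ↦ ofTimeSpace s y) (basisVector 0) t := by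
  have h : (fun s : ℝ ↦ ofTimeSpace s y) = fun s ↦ s • basisVector 0 + spaceEmbed y :=
    funext fun s ↦ ofTimeSpace_eq_smul_add' s y
  rw [h]
  simpa using ((hasDerivAt_id t).smul_const (basisVector 0)).add_const (spaceEmbed y)

/-- `(t, y) ↦ (t, y) ∈ E4` is continuous (jointly). [folklore] -/
theorem continuous_ofTimeSpace_uncurry : Continuous fun q : ℝ × E3 ↦ ofTimeSpace q.1 q.2 := by
  have : (fun q : ℝ × E3 ↦ ofTimeSpace q.1 q.2) = fun q ↦ q.1 • basisVector 0 + spaceEmbed q.2 :=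
    funext fun q ↦ ofTimeSpace_eq_smul_add' q.1 q.2
  rw [this]
  fun_prop

/-- The embedding sends the spatial coordinate vector `e_i` to `∂_{i+1}` (private copy of the
lemma of the same name in `KerrPriceLaw.lean`, a downstream application file which is not
imported here). [folklore] -/
private theorem spaceEmbed_single_eq (i : Fin 3) :
    spaceEmbed (EuclideanSpace.single i 1) = basisVector i.succ := by
  ext j
  refine Fin.cases ?_ (fun k ↦ ?_) j
  · simp [basisVector, Fin.succ_ne_zero]
  · simp [basisVector, Fin.succ_inj]

/-- Chain rule along a slice: `∂_{y_i} [J(t, y)] = (∂_{i+1} J)(t, y)` (private copy of the lemma of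
the same name in `KerrPriceLaw.lean`, not imported here). [folklore] -/
private theorem fderiv_comp_ofTimeSpace_single {J : E4 → ℝ} {t : ℝ} {y : E3}
    (hJ : DifferentiableAt ℝ J (ofTimeSpace t y)) (i : Fin 3) :
    fderiv ℝ (fun y ↦ J (ofTimeSpace t y)) y (EuclideanSpace.single i 1) =
      fderiv ℝ J (ofTimeSpace t y) (basisVector i.succ) := by
  have h : HasFDerivAt (fun y ↦ J (ofTimeSpace t y)) ((fderiv ℝ J (ofTimeSpace t y)).comp spaceEmbed)
      y := hJ.hasFDerivAt.comp y (hasFDerivAt_ofTimeSpace t y)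
  rw [h.fderiv, ContinuousLinearMap.comp_apply, spaceEmbed_single_eq]

/-- `E4.spatialNorm` is continuous. [folklore] -/
theorem continuous_spatialNorm : Continuous spatialNorm := continuous_norm.comp spatial.continuous

/-- `‖x⃗‖ ≤ ‖x‖` for a point of `E4`. [folklore] -/
theorem spatialNorm_le_norm (x : E4) : spatialNorm x ≤ ‖x‖ := by
  have hs : 0 ≤ spatialNorm x := spatialNorm_nonneg x
  have hsq : ‖x‖ ^ 2 = x 0 ^ 2 + spatialNorm x ^ 2 := by
    rw [EuclideanSpace.norm_sq_eq, Fin.sum_univ_four, spatialNorm_sq]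
    simp only [Real.norm_eq_abs, sq_abs]
    ring
  nlinarith [norm_nonneg x, sq_nonneg (x 0)]

/-- **Functions with the same Cauchy data on `{t = 0}` have the same differential there**: if
`F, G : E4 → ℝ` are differentiable with `F(0, y) = G(0, y)` and `∂_t F(0, y) = ∂_t G(0, y)` for
all `y`, then `dF = dG` at every point of the initial slice (tangential derivatives by the chain
rule along `y ↦ (0, y)`). [folklore] -/
theorem fderiv_eq_of_data_eq {F G : E4 → ℝ} (hF : Differentiable ℝ F) (hG : Differentiable ℝ G)
    (h0 : ∀ y : E3, F (ofTimeSpace 0 y) = G (ofTimeSpace 0 y))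
    (h1 : ∀ y : E3, fderiv ℝ F (ofTimeSpace 0 y) (basisVector 0) =
      fderiv ℝ G (ofTimeSpace 0 y) (basisVector 0)) (y : E3) :
    fderiv ℝ F (ofTimeSpace 0 y) = fderiv ℝ G (ofTimeSpace 0 y) := by
  have hfun : (fun y : E3 ↦ F (ofTimeSpace 0 y)) = fun y ↦ G (ofTimeSpace 0 y) := funext h0
  have hμ : ∀ μ : Fin 4, fderiv ℝ F (ofTimeSpace 0 y) (basisVector μ) =
      fderiv ℝ G (ofTimeSpace 0 y) (basisVector μ) := by
    intro μ
    refine Fin.cases ?_ (fun i ↦ ?_) μ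
    · exact h1 y
    · rw [← fderiv_comp_ofTimeSpace_single (hF _) i, ← fderiv_comp_ofTimeSpace_single (hG _) i, hfun]
  ext v
  rw [Kerr.eq_sum_basisVector v, map_sum, map_sum]
  exact Finset.sum_congr rfl fun μ _ ↦ by rw [map_smul, map_smul, hμ μ]

end E4

/-! ### Two calculus lemmas -/

/-- A function vanishing on an open set has zero derivative there. [folklore] -/
theorem fderiv_eq_zero_of_forall_mem_eq_zero {f : E4 → ℝ} {O : Set E4} (hO : IsOpen O)
    (h0 : ∀ x ∈ O, f x = 0) {x : E4} (hx : x ∈ O) : fderiv ℝ f x = 0 := by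
  have h : f =ᶠ[𝓝 x] fun _ ↦ 0 := Filter.eventually_of_mem (hO.mem_nhds hx) h0
  rw [h.fderiv_eq]
  simp

/-- **No boundary terms on `E3`**: for `g ∈ C¹_c(E3)`, `∫ ∂_v g = 0` (Mathlib's integration by
parts against the constant `1`). [folklore] -/
theorem integral_fderiv_apply_eq_zero_of_hasCompactSupport {g : E3 → ℝ} (hg : ContDiff ℝ 1 g)
    (hc : HasCompactSupport g) (v : E3) : ∫ y, fderiv ℝ g y v = 0 := by
  have h := integral_mul_fderiv_eq_neg_fderiv_mul_of_integrable (μ := (volume : Measure E3))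
    (f := fun _ : E3 ↦ (1 : ℝ)) (g := g) (v := v) ?_ ?_ ?_ (fun z _ ↦ differentiableAt_const _)
    (fun z _ ↦ hg.differentiable one_ne_zero z)
  · simpa using h
  · simp
  · simpa using ((hg.continuous_fderiv one_ne_zero).clm_apply continuous_const)
      |>.integrable_of_hasCompactSupport (hc.fderiv_apply ℝ v)
  · simpa using hg.continuous.integrable_of_hasCompactSupport hc

namespace KerrSchild

namespace Background

variable (B : Background)

/-! ### Regularity of the current, the bulk term and the wave operator for `C²` functions -/

/-- The inverse-metric components of a background are `C¹`. [cite: KerrSchild1965, §2] -/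
theorem contDiff_one_inverseMetric (μ ν : Fin 4) : ContDiff ℝ 1 fun x ↦ B.inverseMetric x μ ν :=
  (B.contDiff_inverseMetric μ ν).of_le (WithTop.coe_le_coe.mpr le_top)

/-- A partial derivative of a `C²` function is `C¹`. [folklore] -/
theorem contDiff_partial {w : E4 → ℝ} (hw : ContDiff ℝ 2 w) (v : E4) :
    ContDiff ℝ 1 fun x ↦ fderiv ℝ w x v :=
  (hw.fderiv_right (m := 1) le_rfl).clm_apply contDiff_const

/-- The `dt`-current of a `C²` function on a background is `C¹`. [folklore] -/
theorem contDiff_normalCurrent {w : E4 → ℝ} (hw : ContDiff ℝ 2 w) (μ : Fin 4) :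
    ContDiff ℝ 1 fun x ↦ normalCurrent B.inverseMetric w x μ := by
  have hp : ∀ ν, ContDiff ℝ 1 fun x ↦ fderiv ℝ w x (E4.basisVector ν) :=
    fun ν ↦ contDiff_partial hw _
  have hg : ∀ α β, ContDiff ℝ 1 fun x ↦ B.inverseMetric x α β := B.contDiff_one_inverseMetric
  unfold normalCurrent
  exact ((ContDiff.sum fun ν _ ↦ (hg μ ν).mul (hp ν)).mul
    (ContDiff.sum fun α _ ↦ (hg 0 α).mul (hp α))).sub
    ((contDiff_const.mul (hg 0 μ)).mul
      (ContDiff.sum fun α _ ↦ ContDiff.sum fun β _ ↦ ((hg α β).mul (hp α)).mul (hp β)))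

/-- The wave operator of a `C²` function on a background is continuous. [folklore] -/
theorem continuous_waveOperator {w : E4 → ℝ} (hw : ContDiff ℝ 2 w) :
    Continuous (waveOperator B.inverseMetric w) := by
  have hp : ∀ ν, ContDiff ℝ 1 fun x ↦ fderiv ℝ w x (E4.basisVector ν) :=
    fun ν ↦ contDiff_partial hw _
  have hg : ∀ α β, ContDiff ℝ 1 fun x ↦ B.inverseMetric x α β := B.contDiff_one_inverseMetric
  have hA : ∀ μ, ContDiff ℝ 1 fun y ↦ ∑ ν, B.inverseMetric y μ ν * fderiv ℝ w y (E4.basisVector ν) :=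
    fun μ ↦ ContDiff.sum fun ν _ ↦ (hg μ ν).mul (hp ν)
  change Continuous fun x ↦ ∑ μ, fderiv ℝ
    (fun y ↦ ∑ ν, B.inverseMetric y μ ν * fderiv ℝ w y (E4.basisVector ν)) x (E4.basisVector μ)
  exact continuous_finsetSum _ fun μ _ ↦
    ((hA μ).continuous_fderiv one_ne_zero).clm_apply continuous_const

/-- The deformation term of a `C²` function on a background is continuous. [folklore] -/
theorem continuous_deformationTerm {w : E4 → ℝ} (hw : ContDiff ℝ 2 w) :
    Continuous (deformationTerm B.inverseMetric w) := by
  have hpc : ∀ ν, Continuous fun x ↦ fderiv ℝ w x (E4.basisVector ν) :=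
    fun ν ↦ (contDiff_partial hw _).continuous
  have hgc : ∀ α β, Continuous fun x ↦ B.inverseMetric x α β :=
    fun α β ↦ (B.contDiff_one_inverseMetric α β).continuous
  have hdgc : ∀ μ α β, Continuous fun x ↦
      fderiv ℝ (fun y ↦ B.inverseMetric y α β) x (E4.basisVector μ) :=
    fun μ α β ↦ ((B.contDiff_one_inverseMetric α β).continuous_fderiv one_ne_zero).clm_apply
      continuous_const
  unfold deformationTerm
  exact ((continuous_finsetSum _ fun μ _ ↦ (continuous_finsetSum _ fun ν _ ↦
      (hgc μ ν).mul (hpc ν)).mul (continuous_finsetSum _ fun β _ ↦ (hdgc μ 0 β).mul (hpc β))).sub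
    ((continuous_const.mul (continuous_finsetSum _ fun μ _ ↦ hdgc μ 0 μ)).mul
      (continuous_finsetSum _ fun α _ ↦ continuous_finsetSum _ fun β _ ↦
        ((hgc α β).mul (hpc α)).mul (hpc β)))).sub
    (continuous_const.mul (continuous_finsetSum _ fun μ _ ↦ (hgc 0 μ).mul
      (continuous_finsetSum _ fun α _ ↦ continuous_finsetSum _ fun β _ ↦
        ((hdgc μ α β).mul (hpc α)).mul (hpc β))))

/-- `X = ∑_α g^{0α} ∂_αw` is continuous for `w` of class `C²`. [folklore] -/
theorem continuous_normalComponent {w : E4 → ℝ} (hw : ContDiff ℝ 2 w) :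
    Continuous fun x ↦ ∑ α, B.inverseMetric x 0 α * fderiv ℝ w x (E4.basisVector α) :=
  continuous_finsetSum _ fun α _ ↦
    (B.contDiff_one_inverseMetric 0 α).continuous.mul (contDiff_partial hw _).continuous

/-- `∑_μ (∂_μ w)²` is continuous for `w` of class `C²`. [folklore] -/
theorem continuous_sumSq {w : E4 → ℝ} (hw : ContDiff ℝ 2 w) :
    Continuous fun x ↦ ∑ μ, fderiv ℝ w x (E4.basisVector μ) ^ 2 :=
  continuous_finsetSum _ fun _ _ ↦ ((contDiff_partial hw _).continuous).pow 2

/-! ### The energy and the space-time norm over balls -/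

/-- The **`T^{00}`-energy of `w` at time `t` in the coordinate ball `{‖y‖ ≤ ρ}`**:
`E_ρ(t) = ∫_{‖y‖ ≤ ρ} P⁰[w](t, y) dy` (the `J^N`-energy through `{t} × B_ρ` up to the
normalisation of `N = −(dt)♯`; Sbierski, Anal. PDE 8 (2015), §2). [cite: Sbierski2015, §2 proof of Thm. 2.1] -/
def ballEnergy (w : E4 → ℝ) (ρ t : ℝ) : ℝ :=
  ∫ y in closedBall (0 : E3) ρ, normalCurrent B.inverseMetric w (E4.ofTimeSpace t y) 0

/-- `∫_{‖y‖ ≤ ρ} (□_G w)²(t, y) dy`, the time-`t` slice of `‖□w‖²_{L²(R_{[0,T]})}`.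
[cite: Sbierski2015, §2 proof of Thm. 2.1] -/
def ballBoxSq (w : E4 → ℝ) (ρ t : ℝ) : ℝ :=
  ∫ y in closedBall (0 : E3) ρ, waveOperator B.inverseMetric w (E4.ofTimeSpace t y) ^ 2

/-- A slice integral over the ball of a continuous function on `E4` is continuous in time
(`continuous_parametric_integral_of_continuous`). [folklore] -/
theorem continuous_ballIntegral {F : E4 → ℝ} (hF : Continuous F) (ρ : ℝ) :
    Continuous fun t : ℝ ↦ ∫ y in closedBall (0 : E3) ρ, F (E4.ofTimeSpace t y) :=
  continuous_parametric_integral_of_continuous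
    (f := fun (t : ℝ) (y : E3) ↦ F (E4.ofTimeSpace t y))
    (hF.comp E4.continuous_ofTimeSpace_uncurry) (isCompact_closedBall _ _)

/-- The ball energy of a `C²` function is continuous in time. [folklore] -/
theorem continuous_ballEnergy {w : E4 → ℝ} (hw : ContDiff ℝ 2 w) (ρ : ℝ) :
    Continuous (B.ballEnergy w ρ) :=
  continuous_ballIntegral (B.contDiff_normalCurrent hw 0).continuous ρ

/-- `t ↦ ∫_{B_ρ} (□w)²(t, ·)` is continuous for `w` of class `C²`. [folklore] -/
theorem continuous_ballBoxSq {w : E4 → ℝ} (hw : ContDiff ℝ 2 w) (ρ : ℝ) :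
    Continuous (B.ballBoxSq w ρ) :=
  continuous_ballIntegral ((B.continuous_waveOperator hw).pow 2) ρ

/-- `∫_{B_ρ} (□w)² ≥ 0`. [folklore] -/
theorem ballBoxSq_nonneg (w : E4 → ℝ) (ρ t : ℝ) : 0 ≤ B.ballBoxSq w ρ t :=
  setIntegral_nonneg measurableSet_closedBall fun _ _ ↦ sq_nonneg _

/-- `T^{00} ≥ 0` pointwise on a background. [cite: DafermosRodnianski2008, App. D] -/
theorem normalCurrent_zero_nonneg (w : E4 → ℝ) (x : E4) :
    0 ≤ normalCurrent B.inverseMetric w x 0 :=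
  le_trans (by positivity) (B.half_sq_add_half_sq_le_normalCurrent_zero w x)

/-- The ball energy is nonnegative. [folklore] -/
theorem ballEnergy_nonneg (w : E4 → ℝ) (ρ t : ℝ) : 0 ≤ B.ballEnergy w ρ t :=
  setIntegral_nonneg measurableSet_closedBall fun _ _ ↦ B.normalCurrent_zero_nonneg w _

/-! ### The energy estimate -/

/-- **The energy identity in a ball, for functions supported in the cylinder over it.** Let `w`
be `C²` on `ℝ⁴` with `w = 0` on `{−1 < t < T + 1} ∩ {‖x⃗‖ > ρ}`. Then for `0 ≤ τ ≤ T`,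
`E_ρ(τ) − E_ρ(0) = ∫_0^τ ∫_{B_ρ} ((□_G w) X + R)(t, y) dy dt`: integrate
`∂_0 P⁰ = ∑_μ ∂_μ P^μ − ∑_i ∂_i P^i = (□w) X + R − ∑_i ∂_i P^i` (`sum_fderiv_normalCurrent`) over
`[0, τ] × B_ρ` (fundamental theorem of calculus in `t`, Fubini), the spatial divergence
integrating to zero because the current vanishes near `{‖y‖ = ρ}` (the differential form of
"Stokes' theorem applied to `J^N(u) ⌟ vol`", Sbierski, Anal. PDE 8 (2015), §2, proof of Thm. 2.1;
Alinhac 2009, Ch. 7). [cite: Sbierski2015, §2 proof of Thm. 2.1] -/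
theorem ballEnergy_sub_eq {w : E4 → ℝ} (hw : ContDiff ℝ 2 w) {T ρ : ℝ}
    (hsupp : ∀ x : E4, -1 < x 0 → x 0 < T + 1 → ρ < E4.spatialNorm x → w x = 0)
    {τ : ℝ} (hτ0 : 0 ≤ τ) (hτT : τ ≤ T) :
    B.ballEnergy w ρ τ - B.ballEnergy w ρ 0 =
      ∫ t in Set.Ioc 0 τ, ∫ y in closedBall (0 : E3) ρ,
        (waveOperator B.inverseMetric w (E4.ofTimeSpace t y) *
            (∑ α, B.inverseMetric (E4.ofTimeSpace t y) 0 α *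
              fderiv ℝ w (E4.ofTimeSpace t y) (E4.basisVector α)) +
          deformationTerm B.inverseMetric w (E4.ofTimeSpace t y)) := by
  -- notation
  set G := B.inverseMetric with hG
  set J : Fin 4 → E4 → ℝ := fun μ x ↦ normalCurrent G w x μ with hJ
  set O : Set E4 := {x | -1 < x 0 ∧ x 0 < T + 1 ∧ ρ < E4.spatialNorm x} with hO
  have hOopen : IsOpen O :=
    (isOpen_lt continuous_const (E4.dx 0).continuous).inter
      ((isOpen_lt (E4.dx 0).continuous continuous_const).inter
        (isOpen_lt continuous_const E4.continuous_spatialNorm))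
  -- regularity
  have hJ1 : ∀ μ, ContDiff ℝ 1 (J μ) := fun μ ↦ B.contDiff_normalCurrent hw μ
  have hJd : ∀ μ x, DifferentiableAt ℝ (J μ) x := fun μ x ↦ (hJ1 μ).differentiable one_ne_zero x
  have hdJc : ∀ μ (v : E4), Continuous fun x ↦ fderiv ℝ (J μ) x v :=
    fun μ v ↦ ((hJ1 μ).continuous_fderiv one_ne_zero).clm_apply continuous_const
  -- vanishing on `O`
  have hw0 : ∀ x ∈ O, fderiv ℝ w x = 0 := fun x hx ↦
    fderiv_eq_zero_of_forall_mem_eq_zero hOopen (fun y hy ↦ hsupp y hy.1 hy.2.1 hy.2.2) hx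
  have hJ0 : ∀ μ, ∀ x ∈ O, J μ x = 0 := fun μ x hx ↦
    normalCurrent_eq_zero_of_fderiv_eq_zero G (hw0 x hx) μ
  have hdJ0 : ∀ μ, ∀ x ∈ O, fderiv ℝ (J μ) x = 0 := fun μ x hx ↦
    fderiv_eq_zero_of_forall_mem_eq_zero hOopen (hJ0 μ) hx
  have hmemO : ∀ {t : ℝ} {y : E3}, -1 < t → t < T + 1 → ρ < ‖y‖ → E4.ofTimeSpace t y ∈ O :=
    fun {t} {y} h1 h2 h3 ↦ ⟨by simpa using h1, by simpa using h2, by simpa using h3⟩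
  -- the pointwise divergence identity, solved for `∂_0 P⁰`
  have hdiv : ∀ x, fderiv ℝ (J 0) x (E4.basisVector 0) =
      (waveOperator G w x * (∑ α, G x 0 α * fderiv ℝ w x (E4.basisVector α)) +
        deformationTerm G w x) -
      ∑ i : Fin 3, fderiv ℝ (J i.succ) x (E4.basisVector i.succ) := by
    intro x
    have h := sum_fderiv_normalCurrent (B.differentiableAt_inverseMetric x)
      (B.inverseMetric_symm x) (hw.contDiffAt (x := x))
    rw [Fin.sum_univ_succ] at h
    rw [← h]
    ring
  -- ### Step 1: fundamental theorem of calculus in `t`, pointwise in `y`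
  have hFTC : ∀ y : E3, J 0 (E4.ofTimeSpace τ y) - J 0 (E4.ofTimeSpace 0 y) =
      ∫ t in (0 : ℝ)..τ, fderiv ℝ (J 0) (E4.ofTimeSpace t y) (E4.basisVector 0) := by
    intro y
    rw [intervalIntegral.integral_eq_sub_of_hasDerivAt]
    · intro t _
      exact (hJd 0 _).hasFDerivAt.comp_hasDerivAt t (E4.hasDerivAt_ofTimeSpace_left t y)
    · exact ((hdJc 0 _).comp (E4.continuous_ofTimeSpace_uncurry.comp
        (continuous_id.prodMk continuous_const))).intervalIntegrable _ _
  -- ### Step 2: integrate over the ball and swap the integrals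
  have hK : IsCompact (closedBall (0 : E3) ρ ×ˢ Set.Icc (0 : ℝ) τ) :=
    (isCompact_closedBall _ _).prod isCompact_Icc
  have hF : Continuous fun p : E3 × ℝ ↦ fderiv ℝ (J 0) (E4.ofTimeSpace p.2 p.1) (E4.basisVector 0) :=
    (hdJc 0 _).comp (E4.continuous_ofTimeSpace_uncurry.comp (continuous_snd.prodMk continuous_fst))
  have hInt : Integrable (Function.uncurry fun (y : E3) (t : ℝ) ↦
      fderiv ℝ (J 0) (E4.ofTimeSpace t y) (E4.basisVector 0))
      ((volume.restrict (closedBall (0 : E3) ρ)).prod (volume.restrict (Set.Ioc (0 : ℝ) τ))) := by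
    rw [Measure.prod_restrict, ← Measure.volume_eq_prod]
    exact ((hF.continuousOn.integrableOn_compact hK).mono_set
      (Set.prod_mono le_rfl Set.Ioc_subset_Icc_self))
  have hswap := integral_integral_swap hInt
  -- ### Step 3: the spatial divergence integrates to zero on each slice
  have hslice : ∀ t : ℝ, -1 < t → t < T + 1 →
      ∫ y in closedBall (0 : E3) ρ, fderiv ℝ (J 0) (E4.ofTimeSpace t y) (E4.basisVector 0) =
      ∫ y in closedBall (0 : E3) ρ,
        (waveOperator G w (E4.ofTimeSpace t y) *
            (∑ α, G (E4.ofTimeSpace t y) 0 α *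
              fderiv ℝ w (E4.ofTimeSpace t y) (E4.basisVector α)) +
          deformationTerm G w (E4.ofTimeSpace t y)) := by
    intro t ht1 ht2
    simp only [hdiv]
    have hint1 : IntegrableOn (fun y : E3 ↦ waveOperator G w (E4.ofTimeSpace t y) *
        (∑ α, G (E4.ofTimeSpace t y) 0 α * fderiv ℝ w (E4.ofTimeSpace t y) (E4.basisVector α)) +
          deformationTerm G w (E4.ofTimeSpace t y)) (closedBall (0 : E3) ρ) :=
      ((((B.continuous_waveOperator hw).mul (B.continuous_normalComponent hw)).add
        (B.continuous_deformationTerm hw)).comp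
          (E4.continuous_ofTimeSpace t)).continuousOn.integrableOn_compact (isCompact_closedBall _ _)
    have hint2 : ∀ i : Fin 3, IntegrableOn
        (fun y : E3 ↦ fderiv ℝ (J i.succ) (E4.ofTimeSpace t y) (E4.basisVector i.succ))
        (closedBall (0 : E3) ρ) := fun i ↦
      ((hdJc _ _).comp (E4.continuous_ofTimeSpace t)).continuousOn.integrableOn_compact
        (isCompact_closedBall _ _)
    rw [integral_sub hint1 (integrable_finsetSum _ fun i _ ↦ hint2 i), sub_eq_self,
      integral_finsetSum _ fun i _ ↦ hint2 i]
    refine Finset.sum_eq_zero fun i _ ↦ ?_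
    -- `∫_{B_ρ} ∂_{i+1} P^{i+1} = ∫_{E3} ∂_{i+1} P^{i+1} = ∫_{E3} ∂_{y_i} [P^{i+1}(t, ·)] = 0`
    have hzero : ∀ y : E3, y ∉ closedBall (0 : E3) ρ →
        fderiv ℝ (J i.succ) (E4.ofTimeSpace t y) (E4.basisVector i.succ) = 0 := by
      intro y hy
      rw [mem_closedBall, dist_zero_right, not_le] at hy
      rw [hdJ0 _ _ (hmemO ht1 ht2 hy)]
      rfl
    rw [setIntegral_eq_integral_of_forall_compl_eq_zero hzero]
    have hg1 : ContDiff ℝ 1 fun y : E3 ↦ J i.succ (E4.ofTimeSpace t y) :=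
      (hJ1 _).comp (E4.contDiff_ofTimeSpace t)
    have hgc : HasCompactSupport fun y : E3 ↦ J i.succ (E4.ofTimeSpace t y) := by
      refine HasCompactSupport.intro (isCompact_closedBall (0 : E3) ρ) fun y hy ↦ ?_
      rw [mem_closedBall, dist_zero_right, not_le] at hy
      exact hJ0 _ _ (hmemO ht1 ht2 hy)
    have hchain : ∀ y : E3, fderiv ℝ (J i.succ) (E4.ofTimeSpace t y) (E4.basisVector i.succ) =
        fderiv ℝ (fun y : E3 ↦ J i.succ (E4.ofTimeSpace t y)) y (EuclideanSpace.single i 1) :=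
      fun y ↦ (E4.fderiv_comp_ofTimeSpace_single (hJd _ _) i).symm
    simp only [hchain]
    exact integral_fderiv_apply_eq_zero_of_hasCompactSupport hg1 hgc _
  -- ### assemble
  have hEτ : IntegrableOn (fun y : E3 ↦ J 0 (E4.ofTimeSpace τ y)) (closedBall (0 : E3) ρ) :=
    ((hJ1 0).continuous.comp (E4.continuous_ofTimeSpace τ)).continuousOn.integrableOn_compact
      (isCompact_closedBall _ _)
  have hE0 : IntegrableOn (fun y : E3 ↦ J 0 (E4.ofTimeSpace 0 y)) (closedBall (0 : E3) ρ) :=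
    ((hJ1 0).continuous.comp (E4.continuous_ofTimeSpace 0)).continuousOn.integrableOn_compact
      (isCompact_closedBall _ _)
  calc B.ballEnergy w ρ τ - B.ballEnergy w ρ 0
      = ∫ y in closedBall (0 : E3) ρ, (J 0 (E4.ofTimeSpace τ y) - J 0 (E4.ofTimeSpace 0 y)) := by
        rw [ballEnergy, ballEnergy, ← integral_sub hEτ hE0]
    _ = ∫ y in closedBall (0 : E3) ρ, ∫ t in Set.Ioc 0 τ,
          fderiv ℝ (J 0) (E4.ofTimeSpace t y) (E4.basisVector 0) := by
        refine setIntegral_congr_fun measurableSet_closedBall fun y _ ↦ ?_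
        rw [hFTC y, intervalIntegral.integral_of_le hτ0]
    _ = ∫ t in Set.Ioc 0 τ, ∫ y in closedBall (0 : E3) ρ,
          fderiv ℝ (J 0) (E4.ofTimeSpace t y) (E4.basisVector 0) := hswap
    _ = _ := by
        refine setIntegral_congr_fun measurableSet_Ioc fun t ht ↦ ?_
        exact hslice t (by linarith [ht.1]) (by linarith [ht.2])

/-- **The energy estimate for the divergence-form wave operator of a generalised Kerr–Schild
background, in a ball** (Sbierski's `∫_{Σ_τ} J^N·n ≤ C(T) (∫_{Σ_0} J^N·n + ‖□u‖²_{L²(R_{[0,T]})})`,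
Anal. PDE 8 (2015), §2, proof of Thm. 2.1, "(see for example [Taylor], chapter 2.8)", for the
spacetime `(ℝ⁴, η + φ ℓ ⊗ ℓ)` with time function `t` and `N = −(dt)♯`; Alinhac, *Hyperbolic PDE*
(2009), Ch. 7). Let `B` be a background with `0 ≤ φ ≤ Φ`, `w ∈ C²(ℝ⁴)` with `w = 0` on
`{−1 < t < T + 1} ∩ {‖x⃗‖ > ρ}`, and `|∂_μ g^{αβ}| ≤ D` on `{0 ≤ t ≤ T} ∩ {‖x⃗‖ ≤ ρ}`. Then for
`0 ≤ τ ≤ T`, with `C = 1 + 192 (1 + Φ) D`,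
`∫_{B_ρ} ∑_μ (∂_μw)²(τ, y) dy ≤ e^{CT} (18 (1 + Φ)² ∫_{B_ρ} ∑_μ (∂_μw)²(0, y) dy +
  3 ∫_0^T ∫_{B_ρ} (□_G w)²(t, y) dy dt)`.
Proof: the energy identity `ballEnergy_sub_eq`, the pointwise bounds `(□w) X ≤ ½ (□w)² + P⁰`
(`X² ≤ 2 P⁰`), `|R| ≤ 32 (1 + Φ) D ∑ p² ≤ 192 (1 + Φ) D P⁰`, Grönwall's inequality (Mathlib's
`norm_le_gronwallBound_of_norm_deriv_right_le` applied to `τ ↦ ∫_0^τ E_ρ`), and the coercivity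
`∑ p² ≤ 6 P⁰ ≤ 18 (1 + Φ)² ∑ p²`. [cite: Sbierski2015, §2 proof of Thm. 2.1] -/
theorem ballEnergy_estimate {w : E4 → ℝ} (hw : ContDiff ℝ 2 w) {T ρ D : ℝ} (hD0 : 0 ≤ D)
    (hsupp : ∀ x : E4, -1 < x 0 → x 0 < T + 1 → ρ < E4.spatialNorm x → w x = 0)
    (hD : ∀ x : E4, 0 ≤ x 0 → x 0 ≤ T → E4.spatialNorm x ≤ ρ →
      ∀ μ α β, |fderiv ℝ (fun y ↦ B.inverseMetric y α β) x (E4.basisVector μ)| ≤ D)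
    {τ : ℝ} (hτ0 : 0 ≤ τ) (hτT : τ ≤ T) :
    ∫ y in closedBall (0 : E3) ρ, ∑ μ, fderiv ℝ w (E4.ofTimeSpace τ y) (E4.basisVector μ) ^ 2 ≤
      Real.exp ((1 + 192 * (1 + B.bound) * D) * T) *
        (18 * (1 + B.bound) ^ 2 *
            (∫ y in closedBall (0 : E3) ρ, ∑ μ, fderiv ℝ w (E4.ofTimeSpace 0 y) (E4.basisVector μ) ^ 2) +
          3 * ∫ t in Set.Ioc 0 T, B.ballBoxSq w ρ t) := by
  have hT : 0 ≤ T := hτ0.trans hτT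
  set G := B.inverseMetric with hG
  set Φ := B.bound with hΦ
  have hΦ0 : 0 ≤ Φ := (B.φ_nonneg 0).trans (B.φ_le 0)
  set C : ℝ := 1 + 192 * (1 + Φ) * D with hC
  have hCpos : 0 < C := by positivity
  set f : ℝ → ℝ := B.ballEnergy w ρ with hf
  set S : ℝ → ℝ := B.ballBoxSq w ρ with hS
  have hfc : Continuous f := B.continuous_ballEnergy hw ρ
  have hSc : Continuous S := B.continuous_ballBoxSq hw ρ
  have hf0 : ∀ t, 0 ≤ f t := B.ballEnergy_nonneg w ρ
  have hS0 : ∀ t, 0 ≤ S t := B.ballBoxSq_nonneg w ρ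
  -- the integrand of the energy identity and its pointwise bound on `[0, T] × B_ρ`
  set g : ℝ → ℝ := fun t ↦ ∫ y in closedBall (0 : E3) ρ,
    (waveOperator G w (E4.ofTimeSpace t y) *
        (∑ α, G (E4.ofTimeSpace t y) 0 α * fderiv ℝ w (E4.ofTimeSpace t y) (E4.basisVector α)) +
      deformationTerm G w (E4.ofTimeSpace t y)) with hg
  have hgI : Continuous fun x : E4 ↦ waveOperator G w x *
      (∑ α, G x 0 α * fderiv ℝ w x (E4.basisVector α)) + deformationTerm G w x :=
    ((B.continuous_waveOperator hw).mul (B.continuous_normalComponent hw)).add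
      (B.continuous_deformationTerm hw)
  have hgc : Continuous g := continuous_ballIntegral hgI ρ
  have hpt : ∀ t, 0 ≤ t → t ≤ T → ∀ y ∈ closedBall (0 : E3) ρ,
      waveOperator G w (E4.ofTimeSpace t y) *
          (∑ α, G (E4.ofTimeSpace t y) 0 α * fderiv ℝ w (E4.ofTimeSpace t y) (E4.basisVector α)) +
        deformationTerm G w (E4.ofTimeSpace t y) ≤
      2⁻¹ * waveOperator G w (E4.ofTimeSpace t y) ^ 2 +
        C * normalCurrent G w (E4.ofTimeSpace t y) 0 := by
    intro t ht0 htT y hy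
    set x := E4.ofTimeSpace t y with hx
    rw [mem_closedBall, dist_zero_right] at hy
    have hX := B.half_sq_add_half_sq_le_normalCurrent_zero w x
    have hcoer := B.sum_sq_le_six_mul_normalCurrent_zero w x
    have hR := B.abs_deformationTerm_le w x hD0
      (hD x (by simpa [hx] using ht0) (by simpa [hx] using htT) (by simpa [hx] using hy))
    have hP0 := B.normalCurrent_zero_nonneg w x
    have hsp : 0 ≤ fderiv ℝ w x (E4.basisVector 1) ^ 2 + fderiv ℝ w x (E4.basisVector 2) ^ 2 +
        fderiv ℝ w x (E4.basisVector 3) ^ 2 := by positivity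
    set Xv := ∑ α, G x 0 α * fderiv ℝ w x (E4.basisVector α)
    set bx := waveOperator G w x
    have h1 : bx * Xv ≤ 2⁻¹ * bx ^ 2 + 2⁻¹ * Xv ^ 2 := by nlinarith [sq_nonneg (bx - Xv)]
    have h2 : 2⁻¹ * Xv ^ 2 ≤ normalCurrent G w x 0 := by linarith
    have h3 : deformationTerm G w x ≤ 192 * (1 + Φ) * D * normalCurrent G w x 0 := by
      have := le_abs_self (deformationTerm G w x)
      have h4 : 32 * (1 + Φ) * D * ∑ μ, fderiv ℝ w x (E4.basisVector μ) ^ 2 ≤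
          32 * (1 + Φ) * D * (6 * normalCurrent G w x 0) :=
        mul_le_mul_of_nonneg_left hcoer (by positivity)
      linarith
    have h5 : normalCurrent G w x 0 + 192 * (1 + Φ) * D * normalCurrent G w x 0 =
        C * normalCurrent G w x 0 := by rw [hC]; ring
    linarith
  -- ### the integral inequality `f τ' ≤ f 0 + ∫_0^τ' (½ S + C f)` on `[0, T]`
  have hineq : ∀ τ', 0 ≤ τ' → τ' ≤ T →
      f τ' ≤ f 0 + ∫ t in Set.Ioc 0 τ', (2⁻¹ * S t + C * f t) := by
    intro τ' h0 h1
    have hid := B.ballEnergy_sub_eq hw hsupp h0 h1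
    have hmono : ∫ t in Set.Ioc 0 τ', g t ≤ ∫ t in Set.Ioc 0 τ', (2⁻¹ * S t + C * f t) := by
      refine setIntegral_mono_on (hgc.integrableOn_Icc.mono_set Set.Ioc_subset_Icc_self)
        (((continuous_const.mul hSc).add (continuous_const.mul hfc)).integrableOn_Icc.mono_set
          Set.Ioc_subset_Icc_self) measurableSet_Ioc fun t ht ↦ ?_
      have ht0 : 0 ≤ t := ht.1.le
      have htT : t ≤ T := ht.2.trans h1
      -- compare the slice integrals pointwise on the ball
      have hi1 : IntegrableOn (fun y : E3 ↦ waveOperator G w (E4.ofTimeSpace t y) *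
          (∑ α, G (E4.ofTimeSpace t y) 0 α * fderiv ℝ w (E4.ofTimeSpace t y) (E4.basisVector α)) +
            deformationTerm G w (E4.ofTimeSpace t y)) (closedBall (0 : E3) ρ) :=
        (hgI.comp (E4.continuous_ofTimeSpace t)).continuousOn.integrableOn_compact
          (isCompact_closedBall _ _)
      have hc2 : Continuous fun y : E3 ↦ 2⁻¹ * waveOperator G w (E4.ofTimeSpace t y) ^ 2 +
          C * normalCurrent G w (E4.ofTimeSpace t y) 0 :=
        ((continuous_const.mul ((B.continuous_waveOperator hw).pow 2)).add
          (continuous_const.mul (B.contDiff_normalCurrent hw 0).continuous)).comp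
            (E4.continuous_ofTimeSpace t)
      have hi2 : IntegrableOn (fun y : E3 ↦ 2⁻¹ * waveOperator G w (E4.ofTimeSpace t y) ^ 2 +
          C * normalCurrent G w (E4.ofTimeSpace t y) 0) (closedBall (0 : E3) ρ) :=
        hc2.continuousOn.integrableOn_compact (isCompact_closedBall _ _)
      have hi3 : IntegrableOn (fun y : E3 ↦ waveOperator G w (E4.ofTimeSpace t y) ^ 2)
          (closedBall (0 : E3) ρ) :=
        (((B.continuous_waveOperator hw).pow 2).comp
          (E4.continuous_ofTimeSpace t)).continuousOn.integrableOn_compact (isCompact_closedBall _ _)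
      have hi4 : IntegrableOn (fun y : E3 ↦ normalCurrent G w (E4.ofTimeSpace t y) 0)
          (closedBall (0 : E3) ρ) :=
        ((B.contDiff_normalCurrent hw 0).continuous.comp
          (E4.continuous_ofTimeSpace t)).continuousOn.integrableOn_compact (isCompact_closedBall _ _)
      calc g t ≤ ∫ y in closedBall (0 : E3) ρ, (2⁻¹ * waveOperator G w (E4.ofTimeSpace t y) ^ 2 +
            C * normalCurrent G w (E4.ofTimeSpace t y) 0) :=
            setIntegral_mono_on hi1 hi2 measurableSet_closedBall (hpt t ht0 htT)
        _ = 2⁻¹ * S t + C * f t := by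
            rw [MeasureTheory.integral_add (hi3.const_mul _) (hi4.const_mul _),
              MeasureTheory.integral_const_mul, MeasureTheory.integral_const_mul]
            rfl
    linarith
  -- ### Grönwall, applied to `F(τ') = ∫_0^τ' f`
  set A : ℝ := f 0 + 2⁻¹ * ∫ t in Set.Ioc 0 T, S t with hA
  have hSint : IntegrableOn S (Set.Ioc 0 T) := hSc.integrableOn_Icc.mono_set Set.Ioc_subset_Icc_self
  have hA0 : 0 ≤ A := add_nonneg (hf0 0)
    (mul_nonneg (by norm_num) (setIntegral_nonneg measurableSet_Ioc fun t _ ↦ hS0 t))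
  have hineq' : ∀ τ', 0 ≤ τ' → τ' ≤ T → f τ' ≤ A + C * ∫ t in (0 : ℝ)..τ', f t := by
    intro τ' h0 h1
    have h := hineq τ' h0 h1
    have hSI : IntegrableOn S (Set.Ioc 0 τ') := hSint.mono_set (Set.Ioc_subset_Ioc_right h1)
    have hfI : IntegrableOn f (Set.Ioc 0 τ') := hfc.integrableOn_Icc.mono_set Set.Ioc_subset_Icc_self
    rw [MeasureTheory.integral_add (hSI.const_mul _) (hfI.const_mul _), MeasureTheory.integral_const_mul,
      MeasureTheory.integral_const_mul] at h
    have hSmono : ∫ t in Set.Ioc 0 τ', S t ≤ ∫ t in Set.Ioc 0 T, S t :=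
      setIntegral_mono_set hSint (ae_of_all _ fun t ↦ hS0 t)
        (ae_of_all _ (Set.Ioc_subset_Ioc_right h1))
    rw [intervalIntegral.integral_of_le h0]
    nlinarith
  -- the primitive `F`
  set F : ℝ → ℝ := fun u ↦ ∫ t in (0 : ℝ)..u, f t with hF
  have hFderiv : ∀ u, HasDerivAt F (f u) u := fun u ↦
    intervalIntegral.integral_hasDerivAt_right (hfc.intervalIntegrable _ _)
      (hfc.stronglyMeasurableAtFilter _ _) hfc.continuousAt
  have hFcont : Continuous F := continuous_iff_continuousAt.mpr fun u ↦ (hFderiv u).continuousAt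
  have hF0 : ∀ u, 0 ≤ u → 0 ≤ F u := fun u hu ↦ by
    rw [hF]
    exact intervalIntegral.integral_nonneg_of_forall hu fun t ↦ hf0 t
  have hgron := norm_le_gronwallBound_of_norm_deriv_right_le (f := F) (f' := f) (δ := 0) (K := C)
    (ε := A) (a := 0) (b := T) hFcont.continuousOn (fun u _ ↦ (hFderiv u).hasDerivWithinAt)
    (by simp [hF]) (fun u hu ↦ by
      rw [Real.norm_of_nonneg (hf0 u), Real.norm_of_nonneg (hF0 u hu.1)]
      linarith [hineq' u hu.1 hu.2.le])
  have hFτ : F τ ≤ A / C * (Real.exp (C * τ) - 1) := by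
    have h := hgron τ ⟨hτ0, hτT⟩
    rw [Real.norm_of_nonneg (hF0 τ hτ0), gronwallBound_of_K_ne_0 hCpos.ne', sub_zero] at h
    simpa using h
  have hfτ : f τ ≤ A * Real.exp (C * T) := by
    have h1 := hineq' τ hτ0 hτT
    have h2 : C * F τ ≤ A * (Real.exp (C * τ) - 1) := by
      have := mul_le_mul_of_nonneg_left hFτ hCpos.le
      rwa [← mul_assoc, mul_div_cancel₀ _ hCpos.ne'] at this
    have h3 : Real.exp (C * τ) ≤ Real.exp (C * T) := Real.exp_le_exp.mpr (by nlinarith)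
    nlinarith
  -- ### coercivity: `∫ ∑ p² ≤ 6 f(τ)` and `f(0) ≤ 3 (1 + Φ)² ∫ ∑ p²(0)`
  have hcoτ : ∫ y in closedBall (0 : E3) ρ, ∑ μ, fderiv ℝ w (E4.ofTimeSpace τ y) (E4.basisVector μ) ^ 2
      ≤ 6 * f τ := by
    rw [hf, ballEnergy, ← MeasureTheory.integral_const_mul]
    refine setIntegral_mono_on ?_ ?_ measurableSet_closedBall fun y _ ↦
      B.sum_sq_le_six_mul_normalCurrent_zero w _
    · exact ((continuous_sumSq hw).comp (E4.continuous_ofTimeSpace τ)).continuousOn.integrableOn_compact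
        (isCompact_closedBall _ _)
    · exact ((continuous_const.mul (B.contDiff_normalCurrent hw 0).continuous).comp
        (E4.continuous_ofTimeSpace τ)).continuousOn.integrableOn_compact (isCompact_closedBall _ _)
  have hco0 : f 0 ≤ 3 * (1 + Φ) ^ 2 *
      ∫ y in closedBall (0 : E3) ρ, ∑ μ, fderiv ℝ w (E4.ofTimeSpace 0 y) (E4.basisVector μ) ^ 2 := by
    rw [hf, ballEnergy, ← MeasureTheory.integral_const_mul]
    refine setIntegral_mono_on ?_ ?_ measurableSet_closedBall fun y _ ↦
      B.normalCurrent_zero_le w _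
    · exact ((B.contDiff_normalCurrent hw 0).continuous.comp
        (E4.continuous_ofTimeSpace 0)).continuousOn.integrableOn_compact (isCompact_closedBall _ _)
    · exact ((continuous_const.mul (continuous_sumSq hw)).comp
        (E4.continuous_ofTimeSpace 0)).continuousOn.integrableOn_compact (isCompact_closedBall _ _)
  -- ### conclusion
  have hexp : 1 ≤ Real.exp (C * T) := Real.one_le_exp (by positivity)
  have hI0 : 0 ≤ ∫ y in closedBall (0 : E3) ρ, ∑ μ, fderiv ℝ w (E4.ofTimeSpace 0 y) (E4.basisVector μ) ^ 2 :=
    setIntegral_nonneg measurableSet_closedBall fun y _ ↦ Finset.sum_nonneg fun _ _ ↦ sq_nonneg _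
  have hIS : 0 ≤ ∫ t in Set.Ioc 0 T, S t := setIntegral_nonneg measurableSet_Ioc fun t _ ↦ hS0 t
  calc _ ≤ 6 * f τ := hcoτ
    _ ≤ 6 * (A * Real.exp (C * T)) := by gcongr
    _ = Real.exp (C * T) * (6 * f 0 + 3 * ∫ t in Set.Ioc 0 T, S t) := by rw [hA]; ring
    _ ≤ Real.exp (C * T) * (18 * (1 + Φ) ^ 2 *
          (∫ y in closedBall (0 : E3) ρ, ∑ μ, fderiv ℝ w (E4.ofTimeSpace 0 y) (E4.basisVector μ) ^ 2) +
        3 * ∫ t in Set.Ioc 0 T, S t) := by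
        refine mul_le_mul_of_nonneg_left ?_ (Real.exp_pos _).le
        linarith

/-- **The energy estimate, global form in `[0, ∞]`-valued integrals** (the shape consumed with
`sliceEnergy` / `slabSqNorm` of `WeightedNorms.lean`): under the hypotheses of
`ballEnergy_estimate`, for `0 ≤ τ ≤ T`,
`∫⁻ ∑_μ (∂_μw)²(τ, y) dy ≤ 18 (1 + Φ)² e^{CT} (∫⁻ ∑_μ (∂_μw)²(0, y) dy + ∫⁻_{0 ≤ t ≤ T} (□_G w)² d⁴x)`,
`C = 1 + 192 (1 + Φ) D` (the coordinate energy vanishes off the ball; Tonelli in `(t, y)`,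
`E4.setLIntegral_timeSlab_eq`). Sbierski, Anal. PDE 8 (2015), §2, proof of Thm. 2.1 (the energy
estimate for `J^N`, `N = −(dt*)♯`). [cite: Sbierski2015, §2 proof of Thm. 2.1] -/
theorem lintegral_energy_estimate {w : E4 → ℝ} (hw : ContDiff ℝ 2 w) {T ρ D : ℝ} (hD0 : 0 ≤ D)
    (hsupp : ∀ x : E4, -1 < x 0 → x 0 < T + 1 → ρ < E4.spatialNorm x → w x = 0)
    (hD : ∀ x : E4, 0 ≤ x 0 → x 0 ≤ T → E4.spatialNorm x ≤ ρ →
      ∀ μ α β, |fderiv ℝ (fun y ↦ B.inverseMetric y α β) x (E4.basisVector μ)| ≤ D)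
    {τ : ℝ} (hτ0 : 0 ≤ τ) (hτT : τ ≤ T) :
    ∫⁻ y : E3, ENNReal.ofReal (∑ μ, fderiv ℝ w (E4.ofTimeSpace τ y) (E4.basisVector μ) ^ 2) ≤
      ENNReal.ofReal (18 * (1 + B.bound) ^ 2 * Real.exp ((1 + 192 * (1 + B.bound) * D) * T)) *
        ((∫⁻ y : E3, ENNReal.ofReal (∑ μ, fderiv ℝ w (E4.ofTimeSpace 0 y) (E4.basisVector μ) ^ 2)) +
          ∫⁻ x in {x : E4 | x 0 ∈ Set.Icc 0 T},
            ENNReal.ofReal (waveOperator B.inverseMetric w x ^ 2)) := by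
  have hT : 0 ≤ T := hτ0.trans hτT
  have hmain := B.ballEnergy_estimate hw hD0 hsupp hD hτ0 hτT
  set Φ := B.bound with hΦ
  have hΦ0 : 0 ≤ Φ := (B.φ_nonneg 0).trans (B.φ_le 0)
  set C : ℝ := 1 + 192 * (1 + Φ) * D with hC
  set e : E4 → ℝ := fun x ↦ ∑ μ, fderiv ℝ w x (E4.basisVector μ) ^ 2 with he
  have hec : Continuous e := continuous_sumSq hw
  have he0 : ∀ x, 0 ≤ e x := fun x ↦ Finset.sum_nonneg fun _ _ ↦ sq_nonneg _
  -- `e` vanishes off the ball on the slices `t ∈ [0, T]`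
  set O : Set E4 := {x | -1 < x 0 ∧ x 0 < T + 1 ∧ ρ < E4.spatialNorm x} with hO
  have hOopen : IsOpen O :=
    (isOpen_lt continuous_const (E4.dx 0).continuous).inter
      ((isOpen_lt (E4.dx 0).continuous continuous_const).inter
        (isOpen_lt continuous_const E4.continuous_spatialNorm))
  have hw0 : ∀ x ∈ O, fderiv ℝ w x = 0 := fun x hx ↦
    fderiv_eq_zero_of_forall_mem_eq_zero hOopen (fun y hy ↦ hsupp y hy.1 hy.2.1 hy.2.2) hx
  have hevan : ∀ t, -1 < t → t < T + 1 → ∀ y : E3, y ∉ closedBall (0 : E3) ρ →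
      e (E4.ofTimeSpace t y) = 0 := by
    intro t h1 h2 y hy
    rw [mem_closedBall, dist_zero_right, not_le] at hy
    have hx : E4.ofTimeSpace t y ∈ O := ⟨by simpa using h1, by simpa using h2, by simpa using hy⟩
    simp [he, hw0 _ hx]
  -- conversion of the ball integrals of `e` to `lintegral`s over `E3`
  have hconv : ∀ t, -1 < t → t < T + 1 →
      ∫⁻ y : E3, ENNReal.ofReal (e (E4.ofTimeSpace t y)) =
        ENNReal.ofReal (∫ y in closedBall (0 : E3) ρ, e (E4.ofTimeSpace t y)) := by
    intro t h1 h2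
    have hint : IntegrableOn (fun y : E3 ↦ e (E4.ofTimeSpace t y)) (closedBall (0 : E3) ρ) :=
      (hec.comp (E4.continuous_ofTimeSpace t)).continuousOn.integrableOn_compact
        (isCompact_closedBall _ _)
    rw [ofReal_integral_eq_lintegral_ofReal hint (ae_of_all _ fun y ↦ he0 _),
      ← lintegral_indicator measurableSet_closedBall]
    refine lintegral_congr fun y ↦ ?_
    by_cases hy : y ∈ closedBall (0 : E3) ρ
    · rw [Set.indicator_of_mem hy]
    · rw [Set.indicator_of_notMem hy, hevan t h1 h2 y hy, ENNReal.ofReal_zero]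
  -- the space-time term: `ofReal (∫_{Ioc} ballBoxSq) ≤ ∫⁻_{slab} ofReal (□w)²`
  have hbox : ENNReal.ofReal (∫ t in Set.Ioc 0 T, B.ballBoxSq w ρ t) ≤
      ∫⁻ x in {x : E4 | x 0 ∈ Set.Icc 0 T}, ENNReal.ofReal (waveOperator B.inverseMetric w x ^ 2) := by
    have hbc : Continuous fun x ↦ waveOperator B.inverseMetric w x ^ 2 :=
      (B.continuous_waveOperator hw).pow 2
    rw [E4.setLIntegral_timeSlab_eq (fun x ↦ ENNReal.ofReal (waveOperator B.inverseMetric w x ^ 2))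
      (ENNReal.measurable_ofReal.comp hbc.measurable) measurableSet_Icc]
    have hSc : Continuous (B.ballBoxSq w ρ) := B.continuous_ballBoxSq hw ρ
    have hS0 : ∀ t, 0 ≤ B.ballBoxSq w ρ t := B.ballBoxSq_nonneg w ρ
    rw [ofReal_integral_eq_lintegral_ofReal (hSc.integrableOn_Icc.mono_set Set.Ioc_subset_Icc_self)
      (ae_of_all _ fun t ↦ hS0 t)]
    calc ∫⁻ t in Set.Ioc 0 T, ENNReal.ofReal (B.ballBoxSq w ρ t)
        ≤ ∫⁻ t in Set.Icc 0 T, ENNReal.ofReal (B.ballBoxSq w ρ t) :=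
          lintegral_mono_set Set.Ioc_subset_Icc_self
      _ ≤ ∫⁻ t in Set.Icc 0 T, ∫⁻ y : E3,
            ENNReal.ofReal (waveOperator B.inverseMetric w (E4.ofTimeSpace t y) ^ 2) := by
          refine lintegral_mono fun t ↦ ?_
          have hI : IntegrableOn
              (fun y : E3 ↦ waveOperator B.inverseMetric w (E4.ofTimeSpace t y) ^ 2)
              (closedBall (0 : E3) ρ) :=
            (hbc.comp (E4.continuous_ofTimeSpace t)).continuousOn.integrableOn_compact
              (isCompact_closedBall _ _)
          rw [ballBoxSq, ofReal_integral_eq_lintegral_ofReal hI (ae_of_all _ fun y ↦ sq_nonneg _)]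
          exact setLIntegral_le_lintegral _ _
  -- assemble in `[0, ∞]`
  have h1 : (-1 : ℝ) < τ := by linarith
  have h2 : τ < T + 1 := by linarith
  rw [hconv τ h1 h2]
  have hK0 : 0 ≤ 18 * (1 + Φ) ^ 2 * Real.exp (C * T) := by positivity
  calc ENNReal.ofReal (∫ y in closedBall (0 : E3) ρ, e (E4.ofTimeSpace τ y))
      ≤ ENNReal.ofReal (Real.exp (C * T) * (18 * (1 + Φ) ^ 2 *
          (∫ y in closedBall (0 : E3) ρ, e (E4.ofTimeSpace 0 y)) +
            3 * ∫ t in Set.Ioc 0 T, B.ballBoxSq w ρ t)) := ENNReal.ofReal_le_ofReal hmain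
    _ ≤ ENNReal.ofReal (18 * (1 + Φ) ^ 2 * Real.exp (C * T) *
          ((∫ y in closedBall (0 : E3) ρ, e (E4.ofTimeSpace 0 y)) +
            ∫ t in Set.Ioc 0 T, B.ballBoxSq w ρ t)) := by
        refine ENNReal.ofReal_le_ofReal ?_
        have hI0 : 0 ≤ ∫ y in closedBall (0 : E3) ρ, e (E4.ofTimeSpace 0 y) :=
          setIntegral_nonneg measurableSet_closedBall fun y _ ↦ he0 _
        have hIS : 0 ≤ ∫ t in Set.Ioc 0 T, B.ballBoxSq w ρ t :=
          setIntegral_nonneg measurableSet_Ioc fun t _ ↦ B.ballBoxSq_nonneg w ρ t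
        have h3 : (3 : ℝ) ≤ 18 * (1 + Φ) ^ 2 := by nlinarith
        have hE : 0 ≤ Real.exp (C * T) := (Real.exp_pos _).le
        nlinarith [mul_nonneg hE hIS, mul_nonneg (mul_nonneg hE hIS) (by linarith : (0:ℝ) ≤ 18 * (1 + Φ) ^ 2 - 3)]
    _ = ENNReal.ofReal (18 * (1 + Φ) ^ 2 * Real.exp (C * T)) *
          (ENNReal.ofReal (∫ y in closedBall (0 : E3) ρ, e (E4.ofTimeSpace 0 y)) +
            ENNReal.ofReal (∫ t in Set.Ioc 0 T, B.ballBoxSq w ρ t)) := by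
        rw [← ENNReal.ofReal_add (setIntegral_nonneg measurableSet_closedBall fun y _ ↦ he0 _)
          (setIntegral_nonneg measurableSet_Ioc fun t _ ↦ B.ballBoxSq_nonneg w ρ t),
          ← ENNReal.ofReal_mul hK0]
    _ ≤ _ := by
        rw [← hconv 0 (by norm_num) (by linarith)]
        exact mul_le_mul_right (add_le_add le_rfl hbox) _

end Background

end KerrSchild

end Literature.Geometry.Lorentzian

end
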